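import Summits.QuantumFields.YangMills.Theorems.SqueezedSkewnessTorusKLReferenceStates
import Summits.QuantumFields.YangMills.Theorems.SqueezedSkewnessTorusKLMixtureLemmas
import HarnessLib

/-!
# ENGINE-KL layer (K4e-b) for `SqueezedSkewness.TorusKL` (stmt-QuantumFields-23204, stub `stub_torusMixtureData`):
# CLASS SUMS — the site-resolved correlation functions of the torus of period `K + 1` over the reference states

From the complex spectral package (`…TorusKLComplexSpectral`) and the reference-state data (`…TorusKLReferenceStates`), for `K ≥ 4`:
(P2) for sites `x = (t, p)`, `y = (t', p')` with `1 ≤ t, t'`, `t + t' ≤ K − 2`, the two-point function `∫ A(y,U) A(x,θU) e^{−βS}` is the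
class sum `Σ_c c^{K−1} Σ_j (|γ_{c,j}|² + ⟪P^{t−1} Ũ(p) ψ, P^{t'−1} Ũ(p') ψ⟫)`; (P1) all one-point functions (forward and reflected, any site)
equal one number `m₁`; (PG) `Σ_c c^{K−1} Σ_j |γ_{c,j}|² = G`; (PCS) the weighted Cauchy–Schwarz bound `m₁² ≤ G · Z(K+1)` (the variance
atom of the Källén–Lehmann form is non-negative).  Seat `ym-line-fcl-p3` g16; route-independent imports; `[folklore]` (Lüscher 1977;
Montvay–Münster §3.2.6 (3.145)); nothing about a summit, NT or the mass gap is proved.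
-/

set_option autoImplicit false

noncomputable section

open MeasureTheory Filter Function
open scoped InnerProductSpace ComplexConjugate ENNReal BigOperators
open Literature.MathematicalPhysics.QuantumFieldTheory Literature.Barriers.QuantumFields
open Literature.Analysis.OperatorTheory

namespace Summit.QuantumFields.YangMills.Theorems.TorusKL

variable {S : ℕ} [NeZero S] {G : Type*} [Group G] [TopologicalSpace G] [IsTopologicalGroup G] [CompactSpace G] [MeasurableSpace G]
  [BorelSpace G] [SecondCountableTopology G] {N : ℕ} (ρ : G →* Matrix (Fin N) (Fin N) ℂ) (β : ℝ)

set_option maxHeartbeats 800000 in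
/-- ★ **CLASS SUMS of the torus of period `K + 1`, `K ≥ 4`** (see the module docstring): reference-state data `(P_k, Ũ_k, ψ_k, γ_k)`
indexed by `k = (c, j)` with (P2) the site-resolved two-point functions, (P1) the constancy `m₁` of the one-point functions, (PG) the sum
`G` of the diagonal atoms and (PCS) `m₁² ≤ G · Z`. [cite: Luscher1977] [cite: MontvayMunster1994, §3.2.6 (3.145)] [cite: ReedSimonI1980, Thm VI.23] -/
theorem exists_class_sums (hρ : Continuous ρ) (hρu : ∀ g, ρ g ∈ Matrix.unitaryGroup (Fin N) ℂ) (hβ : 0 ≤ β) {K : ℕ} (hK : 4 ≤ K) :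
    ∃ (C : Set ℝ) (_ : C.Countable) (d : C → (Fin 3 → ZMod S) → ℕ)
      (Pk : (Σ c : C, (Σ q : Fin 3 → ZMod S, Fin (d c q))) →
        Lp ℂ 2 (Measure.pi fun _ : FinSpatialSite S S S × Fin 3 => haarProbability G) →L[ℂ]
          Lp ℂ 2 (Measure.pi fun _ : FinSpatialSite S S S × Fin 3 => haarProbability G))
      (Ut : (Σ c : C, (Σ q : Fin 3 → ZMod S, Fin (d c q))) → (Fin 3 → ZMod S) →
        Lp ℂ 2 (Measure.pi fun _ : FinSpatialSite S S S × Fin 3 => haarProbability G) →L[ℂ]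
          Lp ℂ 2 (Measure.pi fun _ : FinSpatialSite S S S × Fin 3 => haarProbability G))
      (ψk : (Σ c : C, (Σ q : Fin 3 → ZMod S, Fin (d c q))) → Lp ℂ 2 (Measure.pi fun _ : FinSpatialSite S S S × Fin 3 => haarProbability G))
      (γk : (Σ c : C, (Σ q : Fin 3 → ZMod S, Fin (d c q))) → ℂ) (m₁ Gv : ℝ),
      (∀ c : C, 0 < (c : ℝ)) ∧
      (∀ k, IsSelfAdjoint (Pk k) ∧ IsCompactOperator (Pk k) ∧ (∀ v, 0 ≤ RCLike.re ⟪Pk k v, v⟫_ℂ) ∧ Ut k 0 = 1 ∧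
        (∀ x y, Ut k (x + y) = Ut k x * Ut k y) ∧ (∀ x v, ‖Ut k x v‖ = ‖v‖) ∧ (∀ x, Pk k * Ut k x = Ut k x * Pk k)) ∧
      (∀ x y : Fin (K + 1) × FinSpatialSite S S S, 1 ≤ (x.1 : ℕ) → 1 ≤ (y.1 : ℕ) → (x.1 : ℕ) + (y.1 : ℕ) ≤ K - 2 →
        HasSum (fun c : C => ((c : ℝ) : ℂ) ^ (K - 1) *
          ∑ j : (Σ q : Fin 3 → ZMod S, Fin (d c q)), ((((‖γk ⟨c, j⟩‖ ^ 2 : ℝ)) : ℂ) +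
            ⟪(Pk ⟨c, j⟩ ^ ((x.1 : ℕ) - 1)) (Ut ⟨c, j⟩ ![ZMod.finEquiv S x.2.1, ZMod.finEquiv S x.2.2.1, ZMod.finEquiv S x.2.2.2] (ψk ⟨c, j⟩)),
              (Pk ⟨c, j⟩ ^ ((y.1 : ℕ) - 1)) (Ut ⟨c, j⟩ ![ZMod.finEquiv S y.2.1, ZMod.finEquiv S y.2.2.1, ZMod.finEquiv S y.2.2.2] (ψk ⟨c, j⟩))⟫_ℂ))
          (((∫ U : FinTorusSite S S S (K + 1) × Fin 4 → G,
            (∑ pl : {q : Fin 4 × Fin 4 // q.1 < q.2}, (ρ (finTorusPlaquette U (y.2.toSite y.1) pl.1.1 pl.1.2)).trace.re) *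
            (∑ pl : {q : Fin 4 × Fin 4 // q.1 < q.2}, (ρ (finTorusPlaquette
              (fun e : FinTorusSite S S S (K + 1) × Fin 4 => if e.2 = Fin.last 3 then
                (U ((e.1.1, e.1.2.1, e.1.2.2.1, Fin.rev e.1.2.2.2), Fin.last 3))⁻¹
              else U ((e.1.1, e.1.2.1, e.1.2.2.1, ⟨(K + 1 - e.1.2.2.2.val) % (K + 1), Nat.mod_lt _ e.1.2.2.2.pos⟩), e.2))
              (x.2.toSite x.1) pl.1.1 pl.1.2)).trace.re) *
            Real.exp (-β * ∑ z : FinTorusSite S S S (K + 1), ∑ q : {q : Fin 4 × Fin 4 // q.1 < q.2},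
              ((N : ℝ) - (ρ (finTorusPlaquette U z q.1.1 q.1.2)).trace.re))
            ∂(Measure.pi fun _ : FinTorusSite S S S (K + 1) × Fin 4 => haarProbability G) : ℝ)) : ℂ)) ∧
      (∀ (t : Fin (K + 1)) (p : FinSpatialSite S S S),
        (∫ U : FinTorusSite S S S (K + 1) × Fin 4 → G,
          (∑ pl : {q : Fin 4 × Fin 4 // q.1 < q.2}, (ρ (finTorusPlaquette U (p.toSite t) pl.1.1 pl.1.2)).trace.re) *
            Real.exp (-β * ∑ x : FinTorusSite S S S (K + 1), ∑ q : {q : Fin 4 × Fin 4 // q.1 < q.2},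
              ((N : ℝ) - (ρ (finTorusPlaquette U x q.1.1 q.1.2)).trace.re))
          ∂(Measure.pi fun _ : FinTorusSite S S S (K + 1) × Fin 4 => haarProbability G)) = m₁ ∧
        (∫ U : FinTorusSite S S S (K + 1) × Fin 4 → G,
          (∑ pl : {q : Fin 4 × Fin 4 // q.1 < q.2}, (ρ (finTorusPlaquette
              (fun e : FinTorusSite S S S (K + 1) × Fin 4 => if e.2 = Fin.last 3 then
                (U ((e.1.1, e.1.2.1, e.1.2.2.1, Fin.rev e.1.2.2.2), Fin.last 3))⁻¹
              else U ((e.1.1, e.1.2.1, e.1.2.2.1, ⟨(K + 1 - e.1.2.2.2.val) % (K + 1), Nat.mod_lt _ e.1.2.2.2.pos⟩), e.2))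
              (p.toSite t) pl.1.1 pl.1.2)).trace.re) *
            Real.exp (-β * ∑ x : FinTorusSite S S S (K + 1), ∑ q : {q : Fin 4 × Fin 4 // q.1 < q.2},
              ((N : ℝ) - (ρ (finTorusPlaquette U x q.1.1 q.1.2)).trace.re))
          ∂(Measure.pi fun _ : FinTorusSite S S S (K + 1) × Fin 4 => haarProbability G)) = m₁) ∧
      HasSum (fun c : C => (c : ℝ) ^ (K - 1) * ∑ j : (Σ q : Fin 3 → ZMod S, Fin (d c q)), ‖γk ⟨c, j⟩‖ ^ 2) Gv ∧
      m₁ ^ 2 ≤ Gv * wilsonFinTorusPartition ρ β S S S (K + 1) := by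
  classical
  obtain ⟨A', U', X', C, hCcnt, d, e, hA'sa, hA'c, hA'pos, hU'0, hU'add, hU'norm, hU'A, hX'U, hCpos, horth, hAe, hUe, hZ, hI1, hI1r,
    hI2⟩ := exists_complex_spectral_package (S := S) ρ β hρ hρu hβ
  haveI : Countable C := hCcnt.to_subtype
  obtain ⟨Ut, Pk, γk, ψk, hD, hdiag, hγbd, hmix⟩ :=
    exists_reference_states hA'sa hA'c hA'pos hU'0 hU'add hU'norm hU'A hX'U hCpos horth hAe hUe
  have hZpos : 0 < wilsonFinTorusPartition ρ β S S S (K + 1) := wilsonFinTorusPartition_pos hρ β S S S (K + 1)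
  obtain ⟨Z, hZdef⟩ : ∃ Z : ℝ, Z = wilsonFinTorusPartition ρ β S S S (K + 1) := ⟨_, rfl⟩
  have hZp : 0 < Z := hZdef ▸ hZpos
  obtain ⟨lamk, hlamk⟩ : ∃ lamk : (Σ c : C, (Σ q : Fin 3 → ZMod S, Fin (d c q))) → ℝ, lamk = fun k => (k.1 : ℝ) := ⟨_, rfl⟩
  have hlampos : ∀ k, 0 < lamk k := fun k => by rw [hlamk]; exact hCpos k.1
  -- κ-level trace formula `Σ_k λ_k^{m+2} = Z(m+2)`
  have hZκ : ∀ m : ℕ, HasSum (fun k : (Σ c : C, (Σ q : Fin 3 → ZMod S, Fin (d c q))) => lamk k ^ (m + 2))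
      (wilsonFinTorusPartition ρ β S S S (m + 2)) := by
    intro m
    refine MixtureLemmas.hasSum_sigma_of_nonneg_fibres ?_ (fun k => pow_nonneg (hlampos k).le _)
    have h := hZ m
    simp only [hlamk, Finset.sum_const, Finset.card_univ, nsmul_eq_mul] at h ⊢
    convert h using 2 with c; ring
  -- one-point functions are all equal to `m₁`
  have hKM : K + 1 = (K - 2) + 3 := by omega
  have hKM2 : K - 2 + 2 = K := by omega
  obtain ⟨m₁, hm₁⟩ : ∃ m₁ : ℝ, m₁ = ∫ U : FinTorusSite S S S (K + 1) × Fin 4 → G,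
      (∑ pl : {q : Fin 4 × Fin 4 // q.1 < q.2}, (ρ (finTorusPlaquette U ((0 : FinSpatialSite S S S).toSite (0 : Fin (K + 1)))
        pl.1.1 pl.1.2)).trace.re) *
        Real.exp (-β * ∑ x : FinTorusSite S S S (K + 1), ∑ q : {q : Fin 4 × Fin 4 // q.1 < q.2},
          ((N : ℝ) - (ρ (finTorusPlaquette U x q.1.1 q.1.2)).trace.re))
      ∂(Measure.pi fun _ : FinTorusSite S S S (K + 1) × Fin 4 => haarProbability G) := ⟨_, rfl⟩
  have hseries : ∀ p : FinSpatialSite S S S, (fun c : C => ((c : ℝ) : ℂ) ^ (K - 2 + 2) * ∑ j, ⟪e c j, X' p (e c j)⟫_ℂ) =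
      fun c : C => ((c : ℝ) : ℂ) ^ K * ∑ j : (Σ q : Fin 3 → ZMod S, Fin (d c q)), γk ⟨c, j⟩ := by
    intro p; funext c; rw [hKM2]
    congr 1
    exact Finset.sum_congr rfl fun j _ => by rw [← hdiag ⟨c, j⟩ p]
  have hm₁C : HasSum (fun c : C => ((c : ℝ) : ℂ) ^ K * ∑ j : (Σ q : Fin 3 → ZMod S, Fin (d c q)), γk ⟨c, j⟩) (m₁ : ℂ) := by
    have h := hI1 (K + 1) (K - 2) hKM 0 0
    rw [hseries] at h; rw [hm₁]; exact h
  have hI1eq : ∀ (t : Fin (K + 1)) (p : FinSpatialSite S S S),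
      (∫ U : FinTorusSite S S S (K + 1) × Fin 4 → G,
        (∑ pl : {q : Fin 4 × Fin 4 // q.1 < q.2}, (ρ (finTorusPlaquette U (p.toSite t) pl.1.1 pl.1.2)).trace.re) *
          Real.exp (-β * ∑ x : FinTorusSite S S S (K + 1), ∑ q : {q : Fin 4 × Fin 4 // q.1 < q.2},
            ((N : ℝ) - (ρ (finTorusPlaquette U x q.1.1 q.1.2)).trace.re))
        ∂(Measure.pi fun _ : FinTorusSite S S S (K + 1) × Fin 4 => haarProbability G)) = m₁ := by
    intro t p
    have h := hI1 (K + 1) (K - 2) hKM p t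
    rw [hseries] at h
    exact_mod_cast h.unique hm₁C
  have hI1req : ∀ (t : Fin (K + 1)) (p : FinSpatialSite S S S),
      (∫ U : FinTorusSite S S S (K + 1) × Fin 4 → G,
        (∑ pl : {q : Fin 4 × Fin 4 // q.1 < q.2}, (ρ (finTorusPlaquette
            (fun e : FinTorusSite S S S (K + 1) × Fin 4 => if e.2 = Fin.last 3 then
              (U ((e.1.1, e.1.2.1, e.1.2.2.1, Fin.rev e.1.2.2.2), Fin.last 3))⁻¹
            else U ((e.1.1, e.1.2.1, e.1.2.2.1, ⟨(K + 1 - e.1.2.2.2.val) % (K + 1), Nat.mod_lt _ e.1.2.2.2.pos⟩), e.2))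
            (p.toSite t) pl.1.1 pl.1.2)).trace.re) *
          Real.exp (-β * ∑ x : FinTorusSite S S S (K + 1), ∑ q : {q : Fin 4 × Fin 4 // q.1 < q.2},
            ((N : ℝ) - (ρ (finTorusPlaquette U x q.1.1 q.1.2)).trace.re))
        ∂(Measure.pi fun _ : FinTorusSite S S S (K + 1) × Fin 4 => haarProbability G)) = m₁ := by
    intro t p
    have h := hI1r (K + 1) (K - 2) hKM p t
    rw [hseries] at h
    exact_mod_cast h.unique hm₁C
  -- κ-level sums `Σ λ^K γ = m₁`, `Σ λ^{K-1} ‖γ‖² = G`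
  have hsumK : Summable fun k : (Σ c : C, (Σ q : Fin 3 → ZMod S, Fin (d c q))) => lamk k ^ K :=
    (hKM2 ▸ (hZκ (K - 2))).summable
  have hsumK1 : Summable fun k : (Σ c : C, (Σ q : Fin 3 → ZMod S, Fin (d c q))) => lamk k ^ (K - 1) := by
    have h := (hZκ (K - 3)).summable; rwa [show K - 3 + 2 = K - 1 by omega] at h
  have hm₁κ : HasSum (fun k : (Σ c : C, (Σ q : Fin 3 → ZMod S, Fin (d c q))) => ((lamk k : ℝ) : ℂ) ^ K * γk k) (m₁ : ℂ) := by
    refine MixtureLemmas.hasSum_sigma_of_fintype_fibres (f := fun k => ((lamk k : ℝ) : ℂ) ^ K * γk k) ?_ ?_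
    · simp only [hlamk, Finset.mul_sum] at hm₁C ⊢; exact hm₁C
    · refine Summable.of_nonneg_of_le (fun k => norm_nonneg _) (fun k => ?_) (hsumK.mul_right (‖X' 0‖))
      rw [norm_mul, norm_pow, Complex.norm_real, Real.norm_of_nonneg (hlampos k).le]
      exact mul_le_mul_of_nonneg_left (hγbd k) (pow_nonneg (hlampos k).le _)
  have hGs : Summable fun k : (Σ c : C, (Σ q : Fin 3 → ZMod S, Fin (d c q))) => lamk k ^ (K - 1) * ‖γk k‖ ^ 2 := by
    refine Summable.of_nonneg_of_le (fun k => mul_nonneg (pow_nonneg (hlampos k).le _) (sq_nonneg _))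
      (fun k => mul_le_mul_of_nonneg_left ?_ (pow_nonneg (hlampos k).le _)) (hsumK1.mul_right (‖X' 0‖ ^ 2))
    exact pow_le_pow_left₀ (norm_nonneg _) (hγbd k) 2
  obtain ⟨Gv, hGv⟩ : ∃ Gv : ℝ, Gv = ∑' k : (Σ c : C, (Σ q : Fin 3 → ZMod S, Fin (d c q))), lamk k ^ (K - 1) * ‖γk k‖ ^ 2 := ⟨_, rfl⟩
  have hG : HasSum (fun k : (Σ c : C, (Σ q : Fin 3 → ZMod S, Fin (d c q))) => lamk k ^ (K - 1) * ‖γk k‖ ^ 2) Gv :=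
    hGv ▸ hGs.hasSum
  -- the variance atom
  have hCS : m₁ ^ 2 ≤ Gv * Z := by
    refine MixtureLemmas.sq_le_mul_of_weighted_series (w := fun k => lamk k ^ (K - 1)) (s := lamk) (a := γk)
      (fun k => pow_nonneg (hlampos k).le _) hG ?_ ?_ hZp
    · have h : (fun k : (Σ c : C, (Σ q : Fin 3 → ZMod S, Fin (d c q))) => ((lamk k ^ (K - 1) * lamk k : ℝ) : ℂ) * γk k) =
          fun k => ((lamk k : ℝ) : ℂ) ^ K * γk k := by
        funext k; rw [← pow_succ, show K - 1 + 1 = K by omega]; push_cast; ring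
      rw [h]; exact hm₁κ
    · have h : (fun k : (Σ c : C, (Σ q : Fin 3 → ZMod S, Fin (d c q))) => lamk k ^ (K - 1) * lamk k ^ 2) = fun k => lamk k ^ (K - 1 + 2) := by
        funext k; rw [← pow_add]
      rw [h, hZdef, show K - 1 + 2 = K - 1 + 2 from rfl]
      have h2 := hZκ (K - 1); rwa [show K - 1 + 2 = K + 1 by omega] at h2 ⊢
  refine ⟨C, hCcnt, d, Pk, Ut, ψk, γk, m₁, Gv, hCpos, hD, fun x y hx1 hy1 hxy => ?_, fun t p => ⟨hI1eq t p, hI1req t p⟩, ?_,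
    hZdef ▸ hCS⟩
  · -- (P2): the site-resolved two-point function
    have hab : K = (K - 2 - (x.1 : ℕ) - (y.1 : ℕ)) + ((x.1 : ℕ) + (y.1 : ℕ) - 2) + 4 := by omega
    have h2 := hI2 (K - 2 - (x.1 : ℕ) - (y.1 : ℕ)) ((x.1 : ℕ) + (y.1 : ℕ) - 2) K hab x.2 y.2 x.1 y.1 hx1 (by omega)
    have hpt : ∀ (c : C) (j : (Σ q : Fin 3 → ZMod S, Fin (d c q))),
        ⟪X' x.2 (e c j), (A' ^ ((x.1 : ℕ) + (y.1 : ℕ) - 2 + 2)) (X' y.2 (e c j))⟫_ℂ =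
          (((c : ℝ) : ℂ) ^ ((x.1 : ℕ) + (y.1 : ℕ))) * (((‖γk ⟨c, j⟩‖ ^ 2 : ℝ) : ℂ) +
            ⟪(Pk ⟨c, j⟩ ^ ((x.1 : ℕ) - 1)) (Ut ⟨c, j⟩ ![ZMod.finEquiv S x.2.1, ZMod.finEquiv S x.2.2.1, ZMod.finEquiv S x.2.2.2] (ψk ⟨c, j⟩)),
              (Pk ⟨c, j⟩ ^ ((y.1 : ℕ) - 1)) (Ut ⟨c, j⟩ ![ZMod.finEquiv S y.2.1, ZMod.finEquiv S y.2.2.1, ZMod.finEquiv S y.2.2.2] (ψk ⟨c, j⟩))⟫_ℂ) := by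
      intro c j
      rw [show (x.1 : ℕ) + (y.1 : ℕ) - 2 + 2 = (x.1 : ℕ) + (y.1 : ℕ) by omega]
      exact hmix ⟨c, j⟩ x.2 y.2 x.1 y.1 hx1 hy1
    have hfun : (fun c : C => (((c : ℝ) : ℂ) ^ (K - 2 - (x.1 : ℕ) - (y.1 : ℕ) + 1) *
        ∑ j : (Σ q : Fin 3 → ZMod S, Fin (d c q)), ⟪X' x.2 (e c j), (A' ^ ((x.1 : ℕ) + (y.1 : ℕ) - 2 + 2)) (X' y.2 (e c j))⟫_ℂ)) =
        fun c : C => ((c : ℝ) : ℂ) ^ (K - 1) *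
          ∑ j : (Σ q : Fin 3 → ZMod S, Fin (d c q)), ((((‖γk ⟨c, j⟩‖ ^ 2 : ℝ)) : ℂ) +
            ⟪(Pk ⟨c, j⟩ ^ ((x.1 : ℕ) - 1)) (Ut ⟨c, j⟩ ![ZMod.finEquiv S x.2.1, ZMod.finEquiv S x.2.2.1, ZMod.finEquiv S x.2.2.2] (ψk ⟨c, j⟩)),
              (Pk ⟨c, j⟩ ^ ((y.1 : ℕ) - 1)) (Ut ⟨c, j⟩ ![ZMod.finEquiv S y.2.1, ZMod.finEquiv S y.2.2.1, ZMod.finEquiv S y.2.2.2] (ψk ⟨c, j⟩))⟫_ℂ) := by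
      funext c
      simp only [hpt, ← Finset.mul_sum]
      rw [← mul_assoc, ← pow_add, show K - 2 - (x.1 : ℕ) - (y.1 : ℕ) + 1 + ((x.1 : ℕ) + (y.1 : ℕ)) = K - 1 by omega]
    rw [hfun] at h2
    exact h2
  · -- (PG)
    refine hG.sigma fun c => ?_
    have h := hasSum_fintype fun j : (Σ q : Fin 3 → ZMod S, Fin (d c q)) => lamk ⟨c, j⟩ ^ (K - 1) * ‖γk ⟨c, j⟩‖ ^ 2
    simp only [hlamk, ← Finset.mul_sum] at h ⊢
    exact h

end Summit.QuantumFields.YangMills.Theorems.TorusKL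

end
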